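import Literature.NumberTheory.LFunctions.Zhang2022.DetectorRecipeMoments
import Literature.NumberTheory.LFunctions.Zhang2022.ObjectiveTwinEllKernelForm
import Literature.NumberTheory.LFunctions.Zhang2022.MainTermFormKernel

/-!
# Zhang (2022) design-space objective, twin part 16: ANY detector recipe on the edge direction `k₁ − k₃` —
# a closed form in the six channel moments, and the kernel twin of the §D «vernier» EDGE WITNESSES

Y. Zhang, *Discrete mean estimates and the Landau–Siegel zero*, arXiv:2211.02515v1 (2022)
[Zhang2022LandauSiegel] — an unrefereed manuscript under adjudication. **This file SEARCHES and TYPES; it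
makes no claim about Landau–Siegel zeros, about Theorems 1–2 of the manuscript, or about a repaired (2.32),
until a kernel theorem says so.** LANDAU–SIEGEL programme, cell `landau-siegel`, §A Lean twin serving §D (edge ell,
card «ell-vernier-far-pair»): ls-ref-1's falsifier run (cell STATUS 2026-08-27T00:34:41Z, engine
probes/vern_blind.py 99106d9864cf9e70, float) names two EDGE WITNESS values for certification by «obj-eng-3's kernel
twin»: `FormDet(shiftRecipe(1, 5/2, 7/2))(k₁ − k₃) = −7.3596` and `FormDet(shiftRecipe(1, 11/4, 13/4))(k₁ − k₃) = −2.2985`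
(`‖k₁ − k₃‖² = 2`; `b₀ = 1` exactly = the INADMISSIBLE edge of zero near-detuning, far pair straddling the grid
integer `3`). Here:

* `Det.formDet_recipe_k13` — for EVERY three-channel recipe `R = (W, b, s, n)` (`DetectorMainTermForm`), formula I on
  the one-sided kernel direction `u = k₁ − k₃` (`u(1) = 0`, `u(0) = 0`) is the EXPLICIT linear form in the six channel
  moments of `Det.formDet_eq_moments`:
  `FormDet R (k₁−k₃) = 20π·Re m₀ − 8π·Re(m_s + m_b) + 4π·Re(m_n + m_bs) − (8π/3)·Re m_bn − (16/9)·Im m_bn`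
  (atoms of `k₁ − k₃`: `‖u′‖² = 10π²`, `⟨u′,u⟩ = −4iπ`, `‖u‖² = 2`, `u(0) = 0`, `|∫u|² − ⟨u,S_u⟩ = 8/(9π²) + 4i/(3π)` —
  parts 5/6 of this lineage). CHECKS: the printed moments `(4,15,12,9,32,24)` give `0` (`k₁ − k₃ ∈ ker 𝔅`,
  `formDet_zhang_k13`); the `ℓ`-recipe moments `(4,15ℓ,12ℓ²,9ℓ,32ℓ²,24ℓ³)` give `80π − 192πℓ + 176πℓ² − 64πℓ³`
  (row «ell-K0-pos-001» of B-ell/DESIGN-MAP-ell, part 6's `ellFormQ ℓ 1 0 (−1)`).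
* `Det.shiftW_edge52`, `Det.moments_edge52`, **`Det.formDet_shiftRecipe_edge52_k13`**:
  `FormDet (shiftRecipe (1, 5/2, 7/2)) (k₁ − k₃) = −46π/45 − 112/27` EXACTLY, `∈ (−7.35956, −7.35955)`
  (`formDet_shiftRecipe_edge52_k13_bounds`; ref-1's float −7.3596 ✓): the weights are `W = (4i/15, 5/3, 7/5)`
  (phases `e^{5πi/2} = i`, `e^{iπ} = −1`, `e⁰ = 1` against `v = (15/4, −3/2, 5/2)`).

WHAT THIS IS NOT: not a statement about ADMISSIBLE designs (the card's K1 question lives at `b₀ < 1`, where ref-1 /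
crit-2 report a PSD plateau on 14–45-dimensional exponential spans — a kernel PSD certificate of those scans is NOT
here); not an endorsement of `Det.shiftW` as the manuscript's weights for `b ≠ (1,2,3)` (registry E-010, derivation,
first half). The second witness `(1, 11/4, 13/4)` has weights in `ℚ(√2, i)` and is left to an append.
Theorems only; no new definitions.
-/

noncomputable section

open Complex Real ComplexConjugate Set intervalIntegral
open _root_.MeasureTheory

namespace Literature.NumberTheory.LFunctions.Zhang2022

namespace Det

open Repair Objective

/-! ## Plumbing (local copies of private helpers of parts 5–6) -/

/-- `conj` commutes with the interval integral. [folklore] -/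
private theorem conj_intervalIntegral₁₆ (f : ℝ → ℂ) (a b : ℝ) :
    conj (∫ x in a..b, f x) = ∫ x in a..b, conj (f x) := by
  simp only [intervalIntegral, map_sub, integral_conj]

/-- `‖z‖² = Re² + Im²`. [folklore] -/
private theorem normSq_re_im₁₆ (z : ℂ) : ‖z‖ ^ 2 = z.re ^ 2 + z.im ^ 2 := by
  rw [Complex.sq_norm, Complex.normSq_apply]; ring

/-- `2/(πi) = −(2/π)i`. [folklore] -/
private theorem two_div_pi_I₁₆ : (2 : ℂ) / ((π : ℂ) * Complex.I) = ((-(2 / π) : ℝ) : ℂ) * Complex.I := by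
  have hne : (π : ℂ) * Complex.I ≠ 0 := mul_ne_zero (Complex.ofReal_ne_zero.mpr Real.pi_ne_zero) Complex.I_ne_zero
  rw [div_eq_iff hne]
  push_cast
  have hπ : (π : ℂ) ≠ 0 := Complex.ofReal_ne_zero.mpr Real.pi_ne_zero
  field_simp
  ring_nf
  rw [Complex.I_sq]
  ring

/-- `2/(3πi) = −(2/(3π))i`. [folklore] -/
private theorem two_div_three_pi_I₁₆ :
    (2 : ℂ) / (3 * (π : ℂ) * Complex.I) = ((-(2 / (3 * π)) : ℝ) : ℂ) * Complex.I := by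
  have hne : 3 * (π : ℂ) * Complex.I ≠ 0 :=
    mul_ne_zero (mul_ne_zero three_ne_zero (Complex.ofReal_ne_zero.mpr Real.pi_ne_zero)) Complex.I_ne_zero
  rw [div_eq_iff hne]
  push_cast
  have hπ : (π : ℂ) ≠ 0 := Complex.ofReal_ne_zero.mpr Real.pi_ne_zero
  field_simp
  ring_nf
  rw [Complex.I_sq]
  ring

/-- `x / c_j = x·(1/(jπ))·i` (`c_j = −iπj`). [folklore] -/
private theorem div_afeFreq₁₆ (x : ℂ) {j : ℕ} (hj : j ≠ 0) :
    x / afeFreq j = x * (((1 / (j * π)) : ℝ) : ℂ) * Complex.I := by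
  have hc := afeFreq_ne_zero hj
  rw [div_eq_iff hc]
  unfold afeFreq
  push_cast
  have hπ : (π : ℂ) ≠ 0 := Complex.ofReal_ne_zero.mpr Real.pi_ne_zero
  have hjc : (j : ℂ) ≠ 0 := Nat.cast_ne_zero.mpr hj
  field_simp
  ring_nf
  rw [Complex.I_sq]
  ring

/-- `c_j = −(jπ)·i`. [folklore] -/
private theorem afeFreq_eq₁₆ (j : ℕ) : afeFreq j = ((-(j * π) : ℝ) : ℂ) * Complex.I := by
  unfold afeFreq; push_cast; ring

/-- A combination of `k₁, k₂, k₃` is a kinked profile (entire; `isC1_afeSpan`). [cite: Zhang2022LandauSiegel, §7 Prop 7.1 (7.2)] -/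
theorem kinkedProfile_afeSpan (x₁ x₂ x₃ : ℂ) :
    KinkedProfile (fun y => x₁ * afeDir 1 y + x₂ * afeDir 2 y + x₃ * afeDir 3 y)
      (fun y => x₁ * afeDir' 1 y + x₂ * afeDir' 2 y + x₃ * afeDir' 3 y) where
  cont := (isC1_afeSpan x₁ x₂ x₃).cont
  hasDeriv := fun x hx => ((isC1_afeSpan x₁ x₂ x₃).hasDeriv x hx).hasDerivWithinAt
  memLp := (isC1_afeSpan x₁ x₂ x₃).isH1.memLp

/-! ## Any recipe on `k₁ − k₃` -/

/-- **Formula I of ANY recipe on the edge direction `k₁ − k₃`**, in the six channel moments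
`m₀ = ΣW_j`, `m_s = ΣW_js_j`, `m_n = ΣW_jn_j`, `m_b = ΣW_jb_j`, `m_bs = ΣW_jb_js_j`, `m_bn = ΣW_jb_jn_j`:
`FormDet R (k₁−k₃) = 20π·Re m₀ − 8π·(Re m_s + Re m_b) + 4π·(Re m_n + Re m_bs) − (8π/3)·Re m_bn − (16/9)·Im m_bn`.
[cite: Zhang2022LandauSiegel, Prop 7.1 p.44 with (8.11)–(8.23); §2 (2.13)] -/
theorem formDet_recipe_k13 (R : DetRecipe) :
    FormDet R (fun y => (1:ℂ) * afeDir 1 y + 0 * afeDir 2 y + (-1) * afeDir 3 y)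
        (fun y => (1:ℂ) * afeDir' 1 y + 0 * afeDir' 2 y + (-1) * afeDir' 3 y) =
      20 * π * (∑ j : Fin 3, R.W j).re
        - 8 * π * ((∑ j : Fin 3, R.W j * (R.s j : ℂ)).re + (∑ j : Fin 3, R.W j * (R.b j : ℂ)).re)
        + 4 * π * ((∑ j : Fin 3, R.W j * (R.n j : ℂ)).re
            + (∑ j : Fin 3, R.W j * ((R.b j : ℂ) * (R.s j : ℂ))).re)
        - 8 * π / 3 * (∑ j : Fin 3, R.W j * ((R.b j : ℂ) * (R.n j : ℂ))).re
        - 16 / 9 * (∑ j : Fin 3, R.W j * ((R.b j : ℂ) * (R.n j : ℂ))).im := by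
  set u : ℝ → ℂ := fun y => (1:ℂ) * afeDir 1 y + 0 * afeDir 2 y + (-1) * afeDir 3 y with hu
  set u' : ℝ → ℂ := fun y => (1:ℂ) * afeDir' 1 y + 0 * afeDir' 2 y + (-1) * afeDir' 3 y with hu'
  have hg : KinkedProfile u u' := kinkedProfile_afeSpan 1 0 (-1)
  have hu1 : u 1 = 0 := by
    simp only [hu, afeDir_one]; norm_num
  have hu0 : u 0 = 0 := by
    simp only [hu, afeDir_zero]; norm_num
  rw [formDet_eq_moments hg hu1]
  -- the six moments as opaque complex numbers
  set m0 : ℂ := ∑ j : Fin 3, R.W j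
  set ms : ℂ := ∑ j : Fin 3, R.W j * (R.s j : ℂ)
  set mn : ℂ := ∑ j : Fin 3, R.W j * (R.n j : ℂ)
  set mb : ℂ := ∑ j : Fin 3, R.W j * (R.b j : ℂ)
  set mbs : ℂ := ∑ j : Fin 3, R.W j * ((R.b j : ℂ) * (R.s j : ℂ))
  set mbn : ℂ := ∑ j : Fin 3, R.W j * ((R.b j : ℂ) * (R.n j : ℂ))
  -- the atoms of `k₁ − k₃`
  have hT0 := integral_normSq_afeComb' (1:ℂ) 0 (-1)
  have hT1 := integral_afeComb'_mul_conj (1:ℂ) 0 (-1)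
  have hT1c : ∫ x in (0:ℝ)..1, u x * conj (u' x) =
      conj (∫ x in (0:ℝ)..1, u' x * conj (u x)) := by
    rw [conj_intervalIntegral₁₆]
    refine intervalIntegral.integral_congr fun x _ => ?_
    simp only [map_mul, RingHomCompTriple.comp_apply, RingHom.id_apply, mul_comm]
  have hG := integral_normSq_afeComb (1:ℂ) 0 (-1)
  have hI := integral_afeComb (1:ℂ) 0 (-1)
  have hT4 := integral_afeComb_mul_conj_primitive (1:ℂ) 0 (-1)
  rw [hu0, hT1c]
  simp only [hu, hu'] at hT0 hT1 hG hI hT4 ⊢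
  rw [hT0, hT1, hG, hI, hT4, kernelGramQ, kernelGramQ]
  rw [div_afeFreq₁₆ (1:ℂ) one_ne_zero, div_afeFreq₁₆ (0:ℂ) two_ne_zero,
    div_afeFreq₁₆ (-1:ℂ) (by norm_num : (3:ℕ) ≠ 0), two_div_pi_I₁₆, two_div_three_pi_I₁₆,
    afeFreq_eq₁₆ 1, afeFreq_eq₁₆ 2, afeFreq_eq₁₆ 3]
  have hπ : π ≠ 0 := Real.pi_ne_zero
  simp only [map_add, map_mul, map_neg, map_zero, map_one, Complex.conj_ofReal, Complex.conj_I,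
    normSq_re_im₁₆, Complex.add_re, Complex.add_im, Complex.sub_re, Complex.sub_im, Complex.mul_re, Complex.mul_im,
    Complex.neg_re, Complex.neg_im, Complex.I_re, Complex.I_im, Complex.ofReal_re, Complex.ofReal_im,
    Complex.one_re, Complex.one_im, Complex.zero_re, Complex.zero_im,
    zero_mul, mul_zero, mul_one, one_mul, add_zero, zero_add, sub_zero]
  push_cast
  field_simp
  ring

/-- CHECK 1 — the printed recipe: `FormDet (zhangRecipe) (k₁−k₃) = 0` (`k₁ − k₃ ∈ ker 𝔅`; moments `(4,15,12,9,32,24)`: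
`80 − 8·24 + 4·44 − 64 = 0`). [cite: Zhang2022LandauSiegel, Prop 7.1 p.44; (8.11)–(8.23)] -/
theorem formDet_zhang_k13 :
    FormDet zhangRecipe (fun y => (1:ℂ) * afeDir 1 y + 0 * afeDir 2 y + (-1) * afeDir 3 y)
        (fun y => (1:ℂ) * afeDir' 1 y + 0 * afeDir' 2 y + (-1) * afeDir' 3 y) = 0 := by
  obtain ⟨h0, hs, hn, hb, hbs, hbn⟩ := moments_zhang
  rw [formDet_recipe_k13, h0, hs, hn, hb, hbs, hbn]
  norm_num
  ring

/-! ## The §D edge witness `b = (1, 5/2, 7/2)` -/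

/-- `s(1, 5/2, 7/2) = (6, 9/2, 7/2)`. [cite: Zhang2022LandauSiegel, §8 (8.13)–(8.18)] -/
theorem shiftS_edge52 : shiftS ![1, 5 / 2, 7 / 2] = ![6, 9 / 2, 7 / 2] := by
  funext j; fin_cases j <;> (simp [shiftS]; try norm_num)

/-- `n(1, 5/2, 7/2) = (35/4, 7/2, 5/2)`. [cite: Zhang2022LandauSiegel, §8 (8.13)–(8.18)] -/
theorem shiftN_edge52 : shiftN ![1, 5 / 2, 7 / 2] = ![35 / 4, 7 / 2, 5 / 2] := by
  funext j; fin_cases j <;> (simp [shiftN]; try norm_num)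

/-- **`W(1, 5/2, 7/2) = (4i/15, 5/3, 7/5)`** (phases `e^{5πi/2} = i`, `e^{iπ} = −1`, `e⁰ = 1`; denominators
`v = (15/4, −3/2, 5/2)`). [cite: Zhang2022LandauSiegel, proof of Prop 7.1, (7.19)–(7.21)] -/
theorem shiftW_edge52 : shiftW ![1, 5 / 2, 7 / 2] = ![(4 / 15 : ℂ) * I, 5 / 3, 7 / 5] := by
  funext j
  fin_cases j
  · simp only [shiftW, shiftS, shiftVdm]
    simp only [Fin.zero_eta, Fin.isValue, Matrix.cons_val_zero, Matrix.cons_val_one, Matrix.head_cons,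
      Matrix.cons_val_two, Matrix.tail_cons]
    have h : cexp (I * π * (((5 / 2 + 7 / 2 - 1) / 2 : ℝ) : ℂ)) = I := by
      rw [show (((5 / 2 + 7 / 2 - 1) / 2 : ℝ) : ℂ) = 5 / 2 by push_cast; norm_num,
        show I * π * (5 / 2) = (π / 2 : ℂ) * I + (2 * π) * I by ring, Complex.exp_add, Complex.exp_two_pi_mul_I,
        Complex.exp_mul_I, Complex.cos_pi_div_two, Complex.sin_pi_div_two]
      simp
    rw [h]; push_cast; field_simp; ring_nf; try norm_num
  · simp only [shiftW, shiftS, shiftVdm]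
    simp only [Fin.mk_one, Fin.isValue, Matrix.cons_val_zero, Matrix.cons_val_one, Matrix.head_cons,
      Matrix.cons_val_two, Matrix.tail_cons]
    have h : cexp (I * π * (((7 / 2 + 1 - 5 / 2) / 2 : ℝ) : ℂ)) = -1 := by
      rw [show (((7 / 2 + 1 - 5 / 2) / 2 : ℝ) : ℂ) = 1 by push_cast; norm_num,
        show I * π * 1 = π * I by ring, Complex.exp_pi_mul_I]
    rw [h]; push_cast; norm_num
  · simp only [shiftW, shiftS, shiftVdm]
    simp only [Fin.reduceFinMk, Fin.isValue, Matrix.cons_val_zero, Matrix.cons_val_one, Matrix.head_cons,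
      Matrix.cons_val_two, Matrix.tail_cons]
    have h : cexp (I * π * (((1 + 5 / 2 - 7 / 2) / 2 : ℝ) : ℂ)) = 1 := by
      rw [show (((1 + 5 / 2 - 7 / 2) / 2 : ℝ) : ℂ) = 0 by push_cast; norm_num, mul_zero, Complex.exp_zero]
    rw [h]; push_cast; norm_num

/-- The six channel moments of `shiftRecipe (1, 5/2, 7/2)`:
`(m₀, m_s, m_n, m_b, m_bs, m_bn) = (46/15 + 4i/15, 62/5 + 8i/5, 28/3 + 7i/3, 136/15 + 4i/15, 359/10 + 8i/5, 161/6 + 7i/3)`.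
[cite: Zhang2022LandauSiegel, Prop 7.1 p.44, (8.11)–(8.23)] -/
theorem moments_edge52 :
    (∑ j : Fin 3, (shiftRecipe ![1, 5 / 2, 7 / 2]).W j) = 46 / 15 + 4 / 15 * I ∧
    (∑ j : Fin 3, (shiftRecipe ![1, 5 / 2, 7 / 2]).W j * ((shiftRecipe ![1, 5 / 2, 7 / 2]).s j : ℂ))
      = 62 / 5 + 8 / 5 * I ∧
    (∑ j : Fin 3, (shiftRecipe ![1, 5 / 2, 7 / 2]).W j * ((shiftRecipe ![1, 5 / 2, 7 / 2]).n j : ℂ))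
      = 28 / 3 + 7 / 3 * I ∧
    (∑ j : Fin 3, (shiftRecipe ![1, 5 / 2, 7 / 2]).W j * ((shiftRecipe ![1, 5 / 2, 7 / 2]).b j : ℂ))
      = 136 / 15 + 4 / 15 * I ∧
    (∑ j : Fin 3, (shiftRecipe ![1, 5 / 2, 7 / 2]).W j *
        (((shiftRecipe ![1, 5 / 2, 7 / 2]).b j : ℂ) * ((shiftRecipe ![1, 5 / 2, 7 / 2]).s j : ℂ)))
      = 359 / 10 + 8 / 5 * I ∧
    (∑ j : Fin 3, (shiftRecipe ![1, 5 / 2, 7 / 2]).W j *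
        (((shiftRecipe ![1, 5 / 2, 7 / 2]).b j : ℂ) * ((shiftRecipe ![1, 5 / 2, 7 / 2]).n j : ℂ)))
      = 161 / 6 + 7 / 3 * I := by
  simp only [shiftRecipe, shiftW_edge52, shiftS_edge52, shiftN_edge52, Fin.sum_univ_three]
  simp only [Fin.isValue, Matrix.cons_val_zero, Matrix.cons_val_one, Matrix.head_cons, Matrix.cons_val_two,
    Matrix.tail_cons]
  push_cast
  refine ⟨by ring, by ring, by ring, by ring, by ring, by ring⟩

/-- **THE EDGE WITNESS, EXACT**: `FormDet (shiftRecipe (1, 5/2, 7/2)) (k₁ − k₃) = −46π/45 − 112/27`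
(ls-ref-1's float engine: −7.3596; ‖k₁ − k₃‖² = 2). The point `b₀ = 1` is the INADMISSIBLE edge (zero near-detuning).
[cite: Zhang2022LandauSiegel, Prop 7.1 p.44 with (8.11)–(8.23); §2 (2.13)] -/
theorem formDet_shiftRecipe_edge52_k13 :
    FormDet (shiftRecipe ![1, 5 / 2, 7 / 2]) (fun y => (1:ℂ) * afeDir 1 y + 0 * afeDir 2 y + (-1) * afeDir 3 y)
        (fun y => (1:ℂ) * afeDir' 1 y + 0 * afeDir' 2 y + (-1) * afeDir' 3 y) = -(46 * π / 45) - 112 / 27 := by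
  obtain ⟨h0, hs, hn, hb, hbs, hbn⟩ := moments_edge52
  rw [formDet_recipe_k13, h0, hs, hn, hb, hbs, hbn]
  simp only [Complex.add_re, Complex.add_im, Complex.mul_re, Complex.mul_im, Complex.I_re, Complex.I_im,
    Complex.div_ofNat_re, Complex.div_ofNat_im]
  norm_num
  ring

/-- Kernel bracket of the edge witness: `−46π/45 − 112/27 ∈ (−7.35956, −7.35955)`.
[cite: Zhang2022LandauSiegel, Prop 7.1 p.44; §2 (2.13)] -/
theorem formDet_shiftRecipe_edge52_k13_bounds :
    (-7.35956 : ℝ) < -(46 * π / 45) - 112 / 27 ∧ -(46 * π / 45) - 112 / 27 < -7.35955 := by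
  have h1 := Real.pi_gt_d20
  have h2 := Real.pi_lt_d20
  constructor <;> linarith

/-- Hence the edge recipe `(1, 5/2, 7/2)` is NOT PSD in formula I on one-sided kinked profiles (`Det.FormDetPSD` fails,
witness `k₁ − k₃`) — a statement about the continued calculus at an inadmissible shift triple, nothing more.
[cite: Zhang2022LandauSiegel, Prop 7.1 p.44; §2 (2.13)] -/
theorem not_formDetPSD_shiftRecipe_edge52 : ¬ FormDetPSD (shiftRecipe ![1, 5 / 2, 7 / 2]) := by
  intro h
  have hu1 : (fun y : ℝ => (1:ℂ) * afeDir 1 y + 0 * afeDir 2 y + (-1) * afeDir 3 y) 1 = 0 := by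
    simp only [afeDir_one]; norm_num
  have hv := h _ _ (kinkedProfile_afeSpan 1 0 (-1)) hu1
  rw [formDet_shiftRecipe_edge52_k13] at hv
  have := formDet_shiftRecipe_edge52_k13_bounds.2
  linarith

/-! ## Appended: the second §D edge witness `b = (1, 11/4, 13/4)` (`m = 1/4`; weights in `ℚ(√2, i)`) -/

/-- `s(1, 11/4, 13/4) = (6, 17/4, 15/4)`. [cite: Zhang2022LandauSiegel, §8 (8.13)–(8.18)] -/
theorem shiftS_edge1113 : shiftS ![1, 11 / 4, 13 / 4] = ![6, 17 / 4, 15 / 4] := by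
  funext j; fin_cases j <;> (simp [shiftS]; try norm_num)

/-- `n(1, 11/4, 13/4) = (143/16, 13/4, 11/4)`. [cite: Zhang2022LandauSiegel, §8 (8.13)–(8.18)] -/
theorem shiftN_edge1113 : shiftN ![1, 11 / 4, 13 / 4] = ![143 / 16, 13 / 4, 11 / 4] := by
  funext j; fin_cases j <;> (simp [shiftN]; try norm_num)

/-- `cos(3π/4) = −√2/2`. [folklore] -/
private theorem cos_three_pi_div_four : Real.cos (3 * π / 4) = -(Real.sqrt 2 / 2) := by
  rw [show 3 * π / 4 = π - π / 4 by ring, Real.cos_pi_sub, Real.cos_pi_div_four]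

/-- `sin(3π/4) = √2/2`. [folklore] -/
private theorem sin_three_pi_div_four : Real.sin (3 * π / 4) = Real.sqrt 2 / 2 := by
  rw [show 3 * π / 4 = π - π / 4 by ring, Real.sin_pi_sub, Real.sin_pi_div_four]

/-- **`W(1, 11/4, 13/4) = (16i/63, (11√2/7)(1 − i), (13√2/9)(1 + i))`** (phases `e^{5πi/2} = i`, `e^{3πi/4}`,
`e^{πi/4}`; denominators `v = (63/16, −7/8, 9/8)`). [cite: Zhang2022LandauSiegel, proof of Prop 7.1, (7.19)–(7.21)] -/
theorem shiftW_edge1113 : shiftW ![1, 11 / 4, 13 / 4] =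
    ![(16 / 63 : ℂ) * I, ((11 * Real.sqrt 2 / 7 : ℝ) : ℂ) * (1 - I), ((13 * Real.sqrt 2 / 9 : ℝ) : ℂ) * (1 + I)] := by
  funext j
  fin_cases j
  · simp only [shiftW, shiftS, shiftVdm]
    simp only [Fin.zero_eta, Fin.isValue, Matrix.cons_val_zero, Matrix.cons_val_one, Matrix.head_cons,
      Matrix.cons_val_two, Matrix.tail_cons]
    have h : cexp (I * π * (((11 / 4 + 13 / 4 - 1) / 2 : ℝ) : ℂ)) = I := by
      rw [show (((11 / 4 + 13 / 4 - 1) / 2 : ℝ) : ℂ) = 5 / 2 by push_cast; norm_num,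
        show I * π * (5 / 2) = (π / 2 : ℂ) * I + (2 * π) * I by ring, Complex.exp_add, Complex.exp_two_pi_mul_I,
        Complex.exp_mul_I, Complex.cos_pi_div_two, Complex.sin_pi_div_two]
      simp
    rw [h]; push_cast; field_simp; ring_nf; try norm_num
  · simp only [shiftW, shiftS, shiftVdm]
    simp only [Fin.mk_one, Fin.isValue, Matrix.cons_val_zero, Matrix.cons_val_one, Matrix.head_cons,
      Matrix.cons_val_two, Matrix.tail_cons]
    have h : cexp (I * π * (((13 / 4 + 1 - 11 / 4) / 2 : ℝ) : ℂ)) =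
        ((-(Real.sqrt 2 / 2) : ℝ) : ℂ) + ((Real.sqrt 2 / 2 : ℝ) : ℂ) * I := by
      rw [show (((13 / 4 + 1 - 11 / 4) / 2 : ℝ) : ℂ) = ((3 * π / 4 : ℝ) : ℂ) / π by
            push_cast; field_simp [Complex.ofReal_ne_zero.mpr Real.pi_ne_zero]; ring,
        show I * π * (((3 * π / 4 : ℝ) : ℂ) / π) = ((3 * π / 4 : ℝ) : ℂ) * I by
            field_simp [Complex.ofReal_ne_zero.mpr Real.pi_ne_zero],
        Complex.exp_mul_I, ← Complex.ofReal_cos, ← Complex.ofReal_sin, cos_three_pi_div_four, sin_three_pi_div_four]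
    rw [h]; push_cast; field_simp; ring
  · simp only [shiftW, shiftS, shiftVdm]
    simp only [Fin.reduceFinMk, Fin.isValue, Matrix.cons_val_zero, Matrix.cons_val_one, Matrix.head_cons,
      Matrix.cons_val_two, Matrix.tail_cons]
    have h : cexp (I * π * (((1 + 11 / 4 - 13 / 4) / 2 : ℝ) : ℂ)) =
        ((Real.sqrt 2 / 2 : ℝ) : ℂ) + ((Real.sqrt 2 / 2 : ℝ) : ℂ) * I := by
      rw [show (((1 + 11 / 4 - 13 / 4) / 2 : ℝ) : ℂ) = ((π / 4 : ℝ) : ℂ) / π by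
            push_cast; field_simp [Complex.ofReal_ne_zero.mpr Real.pi_ne_zero]; ring,
        show I * π * (((π / 4 : ℝ) : ℂ) / π) = ((π / 4 : ℝ) : ℂ) * I by
            field_simp [Complex.ofReal_ne_zero.mpr Real.pi_ne_zero],
        Complex.exp_mul_I, ← Complex.ofReal_cos, ← Complex.ofReal_sin, Real.cos_pi_div_four, Real.sin_pi_div_four]
    rw [h]; push_cast; field_simp; ring

/-- **THE SECOND EDGE WITNESS, EXACT**:
`FormDet (shiftRecipe (1, 11/4, 13/4)) (k₁ − k₃) = −(95√2/378)·π − 2288/567 + (1144√2/567)` (ls-ref-1's float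
engine: −2.2985; `m = 1/4`, far pair `(11/4, 13/4)` straddling `3`, near shift at the inadmissible edge `b₀ = 1`).
[cite: Zhang2022LandauSiegel, Prop 7.1 p.44 with (8.11)–(8.23); §2 (2.13)] -/
theorem formDet_shiftRecipe_edge1113_k13 :
    FormDet (shiftRecipe ![1, 11 / 4, 13 / 4]) (fun y => (1:ℂ) * afeDir 1 y + 0 * afeDir 2 y + (-1) * afeDir 3 y)
        (fun y => (1:ℂ) * afeDir' 1 y + 0 * afeDir' 2 y + (-1) * afeDir' 3 y) =
      -(95 * Real.sqrt 2 / 378) * π - 2288 / 567 + 1144 * Real.sqrt 2 / 567 := by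
  rw [formDet_recipe_k13]
  simp only [shiftRecipe, shiftW_edge1113, shiftS_edge1113, shiftN_edge1113, Fin.sum_univ_three]
  simp only [Fin.isValue, Matrix.cons_val_zero, Matrix.cons_val_one, Matrix.head_cons, Matrix.cons_val_two,
    Matrix.tail_cons]
  push_cast
  simp only [Complex.add_re, Complex.add_im, Complex.sub_re, Complex.sub_im, Complex.mul_re, Complex.mul_im,
    Complex.I_re, Complex.I_im, Complex.ofReal_re, Complex.ofReal_im, Complex.one_re, Complex.one_im,
    Complex.div_ofNat_re, Complex.div_ofNat_im]
  norm_num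
  ring

/-- Kernel bracket: `−(95√2/378)π − 2288/567 + 1144√2/567 ∈ (−2.29851, −2.2985)`. [cite: Zhang2022LandauSiegel, Prop 7.1 p.44; §2 (2.13)] -/
theorem formDet_shiftRecipe_edge1113_k13_bounds :
    (-2.29851 : ℝ) < -(95 * Real.sqrt 2 / 378) * π - 2288 / 567 + 1144 * Real.sqrt 2 / 567 ∧
      -(95 * Real.sqrt 2 / 378) * π - 2288 / 567 + 1144 * Real.sqrt 2 / 567 < -2.2985 := by
  have h1 := Real.pi_gt_d20
  have h2 := Real.pi_lt_d20
  have hs0 : (0:ℝ) ≤ Real.sqrt 2 := Real.sqrt_nonneg _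
  have hsq : Real.sqrt 2 ^ 2 = 2 := Real.sq_sqrt (by norm_num)
  have hs1 : (1.414213562 : ℝ) < Real.sqrt 2 := by nlinarith
  have hs2 : Real.sqrt 2 < (1.414213563 : ℝ) := by nlinarith
  constructor <;> nlinarith

/-- The second edge triple is likewise NOT PSD in formula I (witness `k₁ − k₃`; inadmissible edge `b₀ = 1`).
[cite: Zhang2022LandauSiegel, Prop 7.1 p.44; §2 (2.13)] -/
theorem not_formDetPSD_shiftRecipe_edge1113 : ¬ FormDetPSD (shiftRecipe ![1, 11 / 4, 13 / 4]) := by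
  intro h
  have hu1 : (fun y : ℝ => (1:ℂ) * afeDir 1 y + 0 * afeDir 2 y + (-1) * afeDir 3 y) 1 = 0 := by
    simp only [afeDir_one]; norm_num
  have hv := h _ _ (kinkedProfile_afeSpan 1 0 (-1)) hu1
  rw [formDet_shiftRecipe_edge1113_k13] at hv
  have := formDet_shiftRecipe_edge1113_k13_bounds.2
  linarith

/-! ## Appended: ANY recipe on the whole wall-vanishing plane `a(k₁+k₂) + b(k₂+k₃)` -/

/-- **Formula I of ANY recipe on the `K₀` plane** `u = a(k₁+k₂) + b(k₂+k₃)` (`= a·k₁ + (a+b)·k₂ + b·k₃`, the whole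
one-sided part `{u(1) = 0}` of `span{k₁,k₂,k₃}`): a Hermitian form `α‖a‖² + δ‖b‖² + γ·Re(ab̄) + γ′·Im(ab̄)` whose four
coefficients are EXPLICIT real-linear forms in the six channel moments —
`α = 10π Re m₀ − 6π Re m_s − 4 Im m_s − 6π Re m_b + 4 Im m_b + 4π Re m_n + 8 Im m_n + 4π Re m_bs − 3π Re m_bn − 4 Im m_bn`,
`δ = 26π Re m₀ − 10π Re m_s − 4 Im m_s − 10π Re m_b + 4 Im m_b + 4π Re m_n + (8/3) Im m_n + 4π Re m_bs − (5π/3) Re m_bn − (4/9) Im m_bn`,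
`γ = 16π Re m₀ − 8π Re m_s − 8 Im m_s − 8π Re m_b + 8 Im m_b + 4π Re m_n + (32/3) Im m_n + 4π Re m_bs − 2π Re m_bn − (8/3) Im m_bn`,
`γ′ = −64 Re m₀ + 32 Re m_s + 32 Re m_b − (64/3) Re m_n − 16 Re m_bs + (32/3) Re m_bn`
(the `ℓ`-recipe gives part 13's `ellFormQ_plane`: `γ′ = −256(1−ℓ)³`; the printed recipe gives `0`; `a = 1, b = −1` is
`formDet_recipe_k13`). The kernel twin of the §D exponential-span eigen-scans restricted to `span{k₁,k₂,k₃}`.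
[cite: Zhang2022LandauSiegel, Prop 7.1 p.44 with (8.11)–(8.23); §2 (2.13)] -/
theorem formDet_recipe_plane (R : DetRecipe) (a b : ℂ) :
    FormDet R (fun y => a * afeDir 1 y + (a + b) * afeDir 2 y + b * afeDir 3 y)
        (fun y => a * afeDir' 1 y + (a + b) * afeDir' 2 y + b * afeDir' 3 y) =
      (10 * π * (∑ j : Fin 3, R.W j).re
          - 6 * π * (∑ j : Fin 3, R.W j * (R.s j : ℂ)).re - 4 * (∑ j : Fin 3, R.W j * (R.s j : ℂ)).im
          - 6 * π * (∑ j : Fin 3, R.W j * (R.b j : ℂ)).re + 4 * (∑ j : Fin 3, R.W j * (R.b j : ℂ)).im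
          + 4 * π * (∑ j : Fin 3, R.W j * (R.n j : ℂ)).re + 8 * (∑ j : Fin 3, R.W j * (R.n j : ℂ)).im
          + 4 * π * (∑ j : Fin 3, R.W j * ((R.b j : ℂ) * (R.s j : ℂ))).re
          - 3 * π * (∑ j : Fin 3, R.W j * ((R.b j : ℂ) * (R.n j : ℂ))).re
          - 4 * (∑ j : Fin 3, R.W j * ((R.b j : ℂ) * (R.n j : ℂ))).im) * ‖a‖ ^ 2
      + (26 * π * (∑ j : Fin 3, R.W j).re
          - 10 * π * (∑ j : Fin 3, R.W j * (R.s j : ℂ)).re - 4 * (∑ j : Fin 3, R.W j * (R.s j : ℂ)).im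
          - 10 * π * (∑ j : Fin 3, R.W j * (R.b j : ℂ)).re + 4 * (∑ j : Fin 3, R.W j * (R.b j : ℂ)).im
          + 4 * π * (∑ j : Fin 3, R.W j * (R.n j : ℂ)).re + 8 / 3 * (∑ j : Fin 3, R.W j * (R.n j : ℂ)).im
          + 4 * π * (∑ j : Fin 3, R.W j * ((R.b j : ℂ) * (R.s j : ℂ))).re
          - 5 * π / 3 * (∑ j : Fin 3, R.W j * ((R.b j : ℂ) * (R.n j : ℂ))).re
          - 4 / 9 * (∑ j : Fin 3, R.W j * ((R.b j : ℂ) * (R.n j : ℂ))).im) * ‖b‖ ^ 2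
      + (16 * π * (∑ j : Fin 3, R.W j).re
          - 8 * π * (∑ j : Fin 3, R.W j * (R.s j : ℂ)).re - 8 * (∑ j : Fin 3, R.W j * (R.s j : ℂ)).im
          - 8 * π * (∑ j : Fin 3, R.W j * (R.b j : ℂ)).re + 8 * (∑ j : Fin 3, R.W j * (R.b j : ℂ)).im
          + 4 * π * (∑ j : Fin 3, R.W j * (R.n j : ℂ)).re + 32 / 3 * (∑ j : Fin 3, R.W j * (R.n j : ℂ)).im
          + 4 * π * (∑ j : Fin 3, R.W j * ((R.b j : ℂ) * (R.s j : ℂ))).re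
          - 2 * π * (∑ j : Fin 3, R.W j * ((R.b j : ℂ) * (R.n j : ℂ))).re
          - 8 / 3 * (∑ j : Fin 3, R.W j * ((R.b j : ℂ) * (R.n j : ℂ))).im) * (a * conj b).re
      + (-64 * (∑ j : Fin 3, R.W j).re
          + 32 * (∑ j : Fin 3, R.W j * (R.s j : ℂ)).re + 32 * (∑ j : Fin 3, R.W j * (R.b j : ℂ)).re
          - 64 / 3 * (∑ j : Fin 3, R.W j * (R.n j : ℂ)).re
          - 16 * (∑ j : Fin 3, R.W j * ((R.b j : ℂ) * (R.s j : ℂ))).re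
          + 32 / 3 * (∑ j : Fin 3, R.W j * ((R.b j : ℂ) * (R.n j : ℂ))).re) * (a * conj b).im := by
  set u : ℝ → ℂ := fun y => a * afeDir 1 y + (a + b) * afeDir 2 y + b * afeDir 3 y with hu
  set u' : ℝ → ℂ := fun y => a * afeDir' 1 y + (a + b) * afeDir' 2 y + b * afeDir' 3 y with hu'
  have hg : KinkedProfile u u' := kinkedProfile_afeSpan a (a + b) b
  have hu1 : u 1 = 0 := by
    simp only [hu, afeDir_one]; ring
  have hu0 : u 0 = 2 * (a + b) := by
    simp only [hu, afeDir_zero]; ring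
  rw [formDet_eq_moments hg hu1]
  set m0 : ℂ := ∑ j : Fin 3, R.W j
  set ms : ℂ := ∑ j : Fin 3, R.W j * (R.s j : ℂ)
  set mn : ℂ := ∑ j : Fin 3, R.W j * (R.n j : ℂ)
  set mb : ℂ := ∑ j : Fin 3, R.W j * (R.b j : ℂ)
  set mbs : ℂ := ∑ j : Fin 3, R.W j * ((R.b j : ℂ) * (R.s j : ℂ))
  set mbn : ℂ := ∑ j : Fin 3, R.W j * ((R.b j : ℂ) * (R.n j : ℂ))
  have hT0 := integral_normSq_afeComb' a (a + b) b
  have hT1 := integral_afeComb'_mul_conj a (a + b) b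
  have hT1c : ∫ x in (0:ℝ)..1, u x * conj (u' x) =
      conj (∫ x in (0:ℝ)..1, u' x * conj (u x)) := by
    rw [conj_intervalIntegral₁₆]
    refine intervalIntegral.integral_congr fun x _ => ?_
    simp only [map_mul, RingHomCompTriple.comp_apply, RingHom.id_apply, mul_comm]
  have hG := integral_normSq_afeComb a (a + b) b
  have hI := integral_afeComb a (a + b) b
  have hT4 := integral_afeComb_mul_conj_primitive a (a + b) b
  rw [hu0, hT1c]
  simp only [hu, hu'] at hT0 hT1 hG hI hT4 ⊢
  rw [hT0, hT1, hG, hI, hT4, kernelGramQ, kernelGramQ]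
  rw [div_afeFreq₁₆ a one_ne_zero, div_afeFreq₁₆ (a + b) two_ne_zero,
    div_afeFreq₁₆ b (by norm_num : (3:ℕ) ≠ 0), two_div_pi_I₁₆, two_div_three_pi_I₁₆,
    afeFreq_eq₁₆ 1, afeFreq_eq₁₆ 2, afeFreq_eq₁₆ 3]
  have hπ : π ≠ 0 := Real.pi_ne_zero
  simp only [map_add, map_mul, map_neg, Complex.conj_ofReal, Complex.conj_I,
    normSq_re_im₁₆, Complex.add_re, Complex.add_im, Complex.sub_re, Complex.sub_im, Complex.mul_re, Complex.mul_im,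
    Complex.neg_re, Complex.neg_im, Complex.I_re, Complex.I_im, Complex.ofReal_re, Complex.ofReal_im,
    Complex.conj_re, Complex.conj_im, Complex.re_ofNat, Complex.im_ofNat,
    zero_mul, mul_zero, mul_one, add_zero, zero_add, sub_zero]
  push_cast
  field_simp
  ring

/-- Consistency: at `a = 1, b = −1` the plane formula is `formDet_recipe_k13`'s (both are the value on `k₁ − k₃`).
[cite: Zhang2022LandauSiegel, Prop 7.1 p.44; §2 (2.13)] -/
theorem formDet_recipe_plane_k13 (R : DetRecipe) :
    FormDet R (fun y => (1:ℂ) * afeDir 1 y + ((1:ℂ) + (-1)) * afeDir 2 y + (-1) * afeDir 3 y)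
        (fun y => (1:ℂ) * afeDir' 1 y + ((1:ℂ) + (-1)) * afeDir' 2 y + (-1) * afeDir' 3 y) =
      20 * π * (∑ j : Fin 3, R.W j).re
        - 8 * π * ((∑ j : Fin 3, R.W j * (R.s j : ℂ)).re + (∑ j : Fin 3, R.W j * (R.b j : ℂ)).re)
        + 4 * π * ((∑ j : Fin 3, R.W j * (R.n j : ℂ)).re
            + (∑ j : Fin 3, R.W j * ((R.b j : ℂ) * (R.s j : ℂ))).re)
        - 8 * π / 3 * (∑ j : Fin 3, R.W j * ((R.b j : ℂ) * (R.n j : ℂ))).re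
        - 16 / 9 * (∑ j : Fin 3, R.W j * ((R.b j : ℂ) * (R.n j : ℂ))).im := by
  rw [formDet_recipe_plane]
  simp
  ring

end Det

end Literature.NumberTheory.LFunctions.Zhang2022
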